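import Summits.QuantumFields.YangMills.Theorems.BalabanUVNodesK0RecordFormatNamesDecay

/-!
# K0⁷ ∕ K1ᴬ — THE RECORD-SIDE FORMAT NAMES, EDITION 25: THE β-KERNEL LETTERS (T-β1) «(1.21) LOCALLY UNIFORMLY ON THE BOX» and (T-β3) «FINITE-VOLUME
# KERNELS CONTINUOUS IN THE HISTORY», generic over a term family; the generic twins of the K0 road's four rate-free box letters; the Stage-13-Ax instances

Cell `ym-nodeO-ideate`, DEFINER seat `ym-nodeO-def-1` (gen 37).  ORDER OF RECORD: director-ym №555 (2)(ℓ1) (nodeO STATUS 2026-08-31T10:34:42Z) «(T-β1)(T-β2)(T-β3) as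
displayed `def … : Prop` letters» on ◆ CRIT-1 g37's K1ᴬ sizing (l.5135: K1ᴬ's `stub_cont13` is an M kernel GIVEN the three β-kernel letters), DEDUP MAP (l.5147:
«(T-β2) = REUSE ✓`PlimDecayOnBoxOf`; (T-β1) = NEW generic `PolLimitLocUnifOnBoxOf`; (T-β3) = NEW generic `PvolHistContOnBoxOf`; do not mint record-keyed triplets»)
and ADDENDUM 2 (l.5152: «the K0 road ALREADY HAS the whole (C) chain at the K0 tuple `thetaFill F a₀ ε₂₉` — (ℓ1) = GENERALISE, not invent»); the generic M kernel
itself is porter ★ PTB-1 g6's ✓`…K1AxBetaContKernel` (p820605, director-ym №559 (A)), whose three HYPOTHESIS BINDERS `h1 ∕ h2 ∕ h3` are, BYTE FOR BYTE, the bodies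
named here — so its theorems apply to these names by unfolding (faces in `…K0RecordFormatNamesLemmas16`, proof lane).
`--kind definition --supports stmt-QuantumFields-20541 --as helper`; count-neutral.  [I] = [Balaban1987RG1].

WHAT THIS FILE IS (definitions only; every letter is a HYPOTHESIS-shaped `Prop` with parameters and ASSERTS NOTHING):
* §1 GENERIC over `fam : TermFamily1 F 𝔄`, `ρ`, `bV` (the idiom of ✓`…K0RecordFormatNamesDecay` §1; kernels `pvolOf ∕ plimOf` of ✓`…K0RecordFormatNames` §19):
  (T-β1) `PolLimitLocUnifOnBoxOf … γ` — for every step `k` and site `z` the finite-volume `(0,1)`-entries `v ↦ pvolOf … k v K 0 1 z` converge LOCALLY UNIFORMLY on the box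
  `]0, γ]^{k+1}` to the limit entry `v ↦ plimOf … k v 0 1 z` as `K → ∞` ([I] (1.21) p.264 «This limit exists by the localized representation (1.7)»: the terms of (1.7)
  not wrapping the torus are volume-independent, so print's convergence is uniform on the box — statement SHAPE only); (T-β3) `PvolHistContOnBoxOf … γ` — every
  finite-volume entry `v ↦ pvolOf … k v K 0 1 z` is continuous on the box (a finite-dimensional integral's parameter dependence; [I] §1 p.264 «It is a C^∞-function
  of g_{j−1}» is stated for the limit).  (T-β2) is ✓`PlimDecayOnBoxOf … γ C δ₁` (edition 12) — NOT re-declared.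
  THE GENERIC TWINS OF THE K0 ROAD's FOUR RATE-FREE BOX LETTERS (✓`…K0AxMomentSocketPvol` §7b, ✓`…K0AxMomentSocketTight` §8b, ✓`…K0AxMomentSocketRows` §6a — there
  hard-wired to `recordPvolAx ∕ recordPlimAx F a₀ ε₂₉`, i.e. to the K0 tuple `thetaFill F a₀ ε₂₉`; here with `pvolOf ∕ plimOf F fam ρ bV`, bodies otherwise verbatim):
  (V-cont-ev) `PvolContEvOnBoxOf` (finite-volume continuity for COFINALLY many volumes), (V-lucauchy) `PvolLocUnifCauchyOnBoxOf` (locally uniformly Cauchy in the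
  volume), (L-cont) `PlimContOnBoxOf` (termwise continuity of the limit entries), (L-dom) `PlimMomentDominatedOnBoxOf` (per-scale summable domination of the
  (1.22)-moment terms).  ORDER (lemma file 16): (L-lim-box)+(V-lucauchy) ⟹ (T-β1); (T-β3) ⟹ (V-cont-ev); (T-β1)+(V-cont-ev) ⟹ (L-cont); (T-β2) ⟹ (L-dom);
  (L-cont)+(L-dom) ⟹ `BetaContH γ (secondMoment ∘ plimOf)`; the K0 letters are these at `(recordTermsAx F a₀ ε₂₉, θfill.ρ8, θfill.bV)` (`Iff.rfl`).
* §2 THE STAGE-13-Ax INSTANCES (thin: each body IS the generic letter at the record's merged family, under the `letI` preamble for `θ`'s carried instances — so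
  that a skeleton can display ONE name per letter at a BOUND witness `θ`): `famOfRecord₁₃Ax F N θ` — the record's merged term family (1.6) over the β-layer
  transport `TβOfRecord₁₃` and the RE-CENTRED (2.9) species `chiβOfRecord₁₃Ax θ` (`recordTermsAx F a₀ ε₂₉` is its value at `θ := thetaFill F a₀ ε₂₉`, `rfl`);
  `PolLimitLocUnifOnBox₁₃Ax ∕ PlimDecayOnBox₁₃Ax ∕ PvolHistContOnBox₁₃Ax F N θ γ [C δ₁]` = (T-β1) ∕ (T-β2) ∕ (T-β3) at `(famOfRecord₁₃Ax F N θ, θ.ρ8, θ.bV)`.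
  Face (lemma file 16, over ✓p820605): `0 < γ₀ ≤ γ ≤ θ.γ`, (T-β1)+(T-β2)+(T-β3) at `θ` on the box of side `γ` ⟹ `SurvCont (betaOfRecord₁₃Ax F N θ) γ₀` — the (C)
  conjunct K1ᴬ's `stub_cont13` adds, over NAMES.

JUNK CENSUS (◆ J1′, pre-applied): every letter is vacuously TRUE at `γ ≤ 0` (`Box γ k = ∅`) and nowhere else cheaply — `pvolOf ∕ plimOf` are PINNED kernels of the given
family (no `∃` over kernels); (T-β1) on a non-empty box contains the convergence of the pinned finite-volume entries to the pinned `limUnder` value; the K1ᴬ doors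
carry `0 < γ₀`.  J5′: (T-β2) is the only decay letter and it is edition 12's, displayed as a hypothesis; nothing here concludes a decay.

HONEST FRAMING.  Definitions only; NOTHING of Bałaban is asserted, ported or discharged — (T-β1)∕(T-β2) are [I] §1∕§5 content at the record, OPEN, discharged by
nobody; (T-β3) is the one letter plausibly provable outright at finite 𝕋⁴ (census owed separately); K1ᴬ ⟨stmt-QuantumFields-27239⟩ 0∕6 stubs; K0ᴬ∕K1ᴬ∕K3ᴬ 0∕3;
NODE O not inhabited (0∕1); COUNT 8∕28 · K 1∕4 UNMOVED; finite `𝕋⁴_{L^K}` at fixed ε — NOT continuum ∕ ℝ⁴ ∕ OS; **the Yang–Mills mass gap (Clay) is NOT proved by any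
of this.**  No `sorry`, `instance`, `notation`; standard axioms.
-/

noncomputable section

open scoped BigOperators Matrix.Norms.L2Operator Topology
open Set Filter

namespace Summit.QuantumFields.YangMills.Theorems.K0RecordFormatNames

open Literature.MathematicalPhysics.QuantumFieldTheory.Balaban1983to89
open Literature.MathematicalPhysics.QuantumFieldTheory.Balaban1983to89.Node00
open Literature.MathematicalPhysics.QuantumFieldTheory.Balaban1983to89.T4Continuum (T4Family)
open Literature.MathematicalPhysics.QuantumFieldTheory.Balaban1983to89.FlowStep

variable (F : T4Family)

/-! ## §1  GENERIC β-kernel letters over a term family (finite volume `pvolOf … K`; limit kernel `plimOf`; the box `]0, γ]^{k+1}`) -/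

section Generic

variable {𝔄 : Type*} [NormedRing 𝔄] [NormedAlgebra ℝ 𝔄]
variable {V : Type*} [NormedAddCommGroup V] [NormedSpace ℝ V] {ι : Type*} [Fintype ι]
variable (fam : TermFamily1 F 𝔄) (ρ : V →L[ℝ] 𝔄) (bV : Module.Basis ι ℝ V)

/-- **(T-β1) — RECEIPT «THE VOLUME LIMIT (1.21) IS LOCALLY UNIFORM IN THE BOX HISTORY» for a term family**: for every step `k` and every site `z ∈ ℤ⁴` the
finite-volume `(0, 1)`-entries `v ↦ pvolOf F fam ρ bV k v K 0 1 z` converge LOCALLY UNIFORMLY on `]0, γ]^{k+1}` to the limit entry `v ↦ plimOf F fam ρ bV k v 0 1 z` as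
`K → ∞` (Mathlib's `TendstoLocallyUniformlyOn`; it contains the pointwise (1.21) letter `PolLimitOnBoxOf` for that entry).  The binder `h1` of
`K1AxBetaContKernel.betaContH_secondMoment_plimOf`, verbatim.  HYPOTHESIS SHAPE; asserts nothing.
[cite: Balaban1987RG1, (1.21) p.264 («This limit exists by the localized representation (1.7)»), (1.7) p.261] -/
def PolLimitLocUnifOnBoxOf (γ : ℝ) : Prop :=
  ∀ (k : ℕ) (z : Fin 4 → ℤ), TendstoLocallyUniformlyOn (fun K v => pvolOf F fam ρ bV k v K 0 1 z)
    (fun v => plimOf F fam ρ bV k v 0 1 z) atTop (Box γ k)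

/-- **(T-β3) — RECEIPT «THE FINITE-VOLUME KERNELS ARE CONTINUOUS IN THE HISTORY ON THE BOX» for a term family**: for every step `k`, volume `K` and site `z` the
entry `v ↦ pvolOf F fam ρ bV k v K 0 1 z` is continuous on `]0, γ]^{k+1}` (a finite torus: a finite-dimensional integral's dependence on the couplings `1∕g_j²`
in its weights).  The binder `h3` of `K1AxBetaContKernel.betaContH_secondMoment_plimOf`, verbatim.  HYPOTHESIS SHAPE; asserts nothing.
[cite: Balaban1987RG1, (1.20)–(1.21) p.264, §1 p.264 («It is a C^∞-function of g_{j−1} ∈ [0, γ]»)] -/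
def PvolHistContOnBoxOf (γ : ℝ) : Prop :=
  ∀ (k K : ℕ) (z : Fin 4 → ℤ), ContinuousOn (fun v => pvolOf F fam ρ bV k v K 0 1 z) (Box γ k)

/-- **(V-cont-ev) — finite-volume history-continuity for COFINALLY many volumes** (the generic twin of `K0AxMomentRoad.RecordPvolContOnBoxAx`: `∃ᶠ K`, the weakest
form `TendstoUniformlyOn.continuousOn` consumes; (T-β3) ⟹ it).  HYPOTHESIS SHAPE; asserts nothing. [cite: Balaban1987RG1, (1.20)–(1.22) p.264] -/
def PvolContEvOnBoxOf (γ : ℝ) : Prop :=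
  ∀ (k : ℕ) (z : Fin 4 → ℤ), ∃ᶠ K in atTop, ContinuousOn (fun v : Fin (k + 1) → ℝ => pvolOf F fam ρ bV k v K 0 1 z) (Box γ k)

/-- **(V-lucauchy) — the volume limit is LOCALLY UNIFORMLY CAUCHY in the box history** (the generic twin of `K0AxMomentRoad.RecordPvolLocUniformCauchyOnBoxAx`): for
each `k`, `z` and box history `v` a neighbourhood `t` of `v` WITHIN the box on which the finite-volume entries are uniformly Cauchy in the volume; with the pointwise
(1.21) letter `PolLimitOnBoxOf` it gives (T-β1) (lemma file 16).  HYPOTHESIS SHAPE; asserts nothing. [cite: Balaban1987RG1, (1.21) p.264, (1.7) p.261] -/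
def PvolLocUnifCauchyOnBoxOf (γ : ℝ) : Prop :=
  ∀ (k : ℕ) (z : Fin 4 → ℤ) (v : Fin (k + 1) → ℝ), v ∈ Box γ k → ∃ t ∈ 𝓝[Box γ k] v,
    UniformCauchySeqOn (fun (K : ℕ) (w : Fin (k + 1) → ℝ) => pvolOf F fam ρ bV k w K 0 1 z) atTop t

/-- **(L-cont) — termwise history-continuity of the LIMIT kernel's `(0,1)`-entries on the box** (the generic twin of `K0AxMomentRoad.RecordPlimContOnBoxAx`; [I] asserts
after (1.22) that the β-functions are smooth in the `g_j`, no proof printed).  HYPOTHESIS SHAPE; asserts nothing. [cite: Balaban1987RG1, §1 p.264 (after (1.22)), (1.21) p.264] -/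
def PlimContOnBoxOf (γ : ℝ) : Prop :=
  ∀ (k : ℕ) (z : Fin 4 → ℤ), ContinuousOn (fun v : Fin (k + 1) → ℝ => plimOf F fam ρ bV k v 0 1 z) (Box γ k)

/-- **(L-dom) — per-scale domination of the (1.22)-moment terms of the LIMIT kernel, uniform in the box history** (the generic twin of
`K0AxMomentRoad.RecordPlimMomentDominatedOnBoxAx`): at EACH step `k` SOME summable `m_k : ℤ⁴ → ℝ` with `|plimOf … k v 0 1 z|·|z₀|·|z₁| ≤ m_k z` for all box histories —
the Weierstrass M-test input and nothing more (no (5.10) rate, no uniformity in `k`; (T-β2) ⟹ it).  HYPOTHESIS SHAPE; asserts nothing.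
[cite: Balaban1987RG1, (1.21)–(1.22) p.264, (5.10) p.293, (5.42) p.297] -/
def PlimMomentDominatedOnBoxOf (γ : ℝ) : Prop :=
  ∀ k : ℕ, ∃ m : (Fin 4 → ℤ) → ℝ, Summable m ∧
    ∀ (v : Fin (k + 1) → ℝ), v ∈ Box γ k → ∀ z : Fin 4 → ℤ, |plimOf F fam ρ bV k v 0 1 z| * |(z 0 : ℝ)| * |(z 1 : ℝ)| ≤ m z

end Generic

/-! ## §2  The Stage-13-Ax INSTANCES at a tuple `θ : Stage13Params F N` (the record's merged family over the RE-CENTRED (2.9) species; thin names over §1) -/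

section Stage13Ax

variable (N : ℕ) [NeZero N]

/-- **The record's merged term family (1.6) at the Stage-13 tuple `θ`, RE-CENTRED**: `mergedTermFamilyMatT F N (TβOfRecord₁₃ F N) (chiβOfRecord₁₃Ax F N θ) θ.εbg` — the
family whose `plimOf`-second-moment IS `betaOfRecord₁₃Ax F N θ` on the box `]0, θ.γ]^{k+1}` (`K0RecordFormatNamesLemmas4.betaOfRecord₈Tχ_of_mem_box`; `betaOfRecord₁₃Ax` unfolds
to `betaOfRecord₈Tχ … θ.toStage8Params` by `rfl`).  At `θ := thetaFill F a₀ ε₂₉` (`N = 2`) it is `recordTermsAx F a₀ ε₂₉` (`rfl`).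
[cite: Balaban1987RG1, (1.6) p.261, (2.13) p.268, (2.9) p.266, (1.20)–(1.22) p.264] -/
def famOfRecord₁₃Ax (θ : Stage13Params F N) : TermFamily1 F (MatA N) :=
  mergedTermFamilyMatT F N (TβOfRecord₁₃ F N) (chiβOfRecord₁₃Ax F N θ) θ.εbg

/-- **(T-β1) AT THE STAGE-13-Ax RECORD `θ`** on the box of side `γ`: `PolLimitLocUnifOnBoxOf` at `(famOfRecord₁₃Ax F N θ, θ.ρ8, θ.bV)` (instance; unfold to use).
HYPOTHESIS SHAPE; asserts nothing. [cite: Balaban1987RG1, (1.21) p.264, (1.7) p.261] -/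
def PolLimitLocUnifOnBox₁₃Ax (θ : Stage13Params F N) (γ : ℝ) : Prop :=
  letI := θ.instVβ₁; letI := θ.instVβ₂; letI := θ.instιβ
  PolLimitLocUnifOnBoxOf F (famOfRecord₁₃Ax F N θ) θ.ρ8 θ.bV γ

/-- **(T-β2) AT THE STAGE-13-Ax RECORD `θ`** on the box of side `γ` with ONE `(C, δ₁)`: edition 12's `PlimDecayOnBoxOf` at `(famOfRecord₁₃Ax F N θ, θ.ρ8, θ.bV)` (instance;
unfold to use) — (5.10) for the `(0,1)`-component of the LIMIT kernel at every box history; [I] §5 content at the record, OPEN.  HYPOTHESIS SHAPE (a decay letter on a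
record-named kernel, displayed under binder — J5′); asserts nothing. [cite: Balaban1987RG1, (5.10) p.293, (1.21) p.264, p.263 («absolute constants»)] -/
def PlimDecayOnBox₁₃Ax (θ : Stage13Params F N) (γ C δ₁ : ℝ) : Prop :=
  letI := θ.instVβ₁; letI := θ.instVβ₂; letI := θ.instιβ
  PlimDecayOnBoxOf F (famOfRecord₁₃Ax F N θ) θ.ρ8 θ.bV γ C δ₁

/-- **(T-β3) AT THE STAGE-13-Ax RECORD `θ`** on the box of side `γ`: `PvolHistContOnBoxOf` at `(famOfRecord₁₃Ax F N θ, θ.ρ8, θ.bV)` (instance; unfold to use) — the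
finite-volume windowed kernels of the record's merged family are continuous in the coupling history.  HYPOTHESIS SHAPE; asserts nothing (the one letter plausibly
provable outright at finite 𝕋⁴). [cite: Balaban1987RG1, (1.20)–(1.21) p.264, §1 p.264] -/
def PvolHistContOnBox₁₃Ax (θ : Stage13Params F N) (γ : ℝ) : Prop :=
  letI := θ.instVβ₁; letI := θ.instVβ₂; letI := θ.instιβ
  PvolHistContOnBoxOf F (famOfRecord₁₃Ax F N θ) θ.ρ8 θ.bV γ

end Stage13Ax

end Summit.QuantumFields.YangMills.Theorems.K0RecordFormatNames

end
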